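import Summits.KontsevichZagierPeriods.KontsevichZagierPeriods.Theorems.MzvKernelInKZ.Negative.SquareDissection

/-!
# `MzvKernelInKZ` (stmt-KontsevichZagierPeriods-3914): negative side — `Q⁴ ≡ 6·[U]` by the bottom-pair dissection of `(0,1)⁴`

Companion of `Negative/SquareDissection.lean`.  `Q⁴ = [(0,1)⁴, g⊗4]` (`G4`, a Fubini product) is
cut by "which two coordinates are the two smallest" into six cells (`bp i j k l`); each is the base
cell `U = {z₀, z₂ < z₁, z₃}` up to a coordinate permutation (`bpRep_equiv`), the cells are peeled off
one at a time by rule (1a) with DISJOINT pieces (`peel4`), and off the six hyperplanes `zₐ = z_b`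
(Lebesgue-null, `Measure.addHaar_submodule`) nothing is left (`S6_subset_walls`, trichotomy).
Hence **`[Q⁴] − 6 • [U] ∈ KZ.relations`** (`of_G4_sub_six_Urep_mem`).

Sources: F. Beukers, J. A. C. Kolk, E. Calabi, *Sums of generalized harmonic series and volumes*, Nieuw Arch. Wisk. (4) 11 (1993), 217–224 (the volume of the polytope `uᵢ + uᵢ₊₁ ≤ 1`); M. Kontsevich, D. Zagier, *Periods* (2001), §1.2 (rules (1a), (2)).
-/

noncomputable section

namespace Summit.KontsevichZagierPeriods.MzvKernelInKZ.Negative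

open Set MeasureTheory MvPolynomial
open Literature.NumberTheory.Transcendental
open Literature.ModelTheory.ExponentialFields (IsSemialgebraic)

/-- Membership in `cube4'`, unfolded. [folklore] -/
theorem mem_cube4' {x : Fin 4 → ℝ} : x ∈ openUnitCube 4 ↔ ∀ i, 0 < x i ∧ x i < 1 := by
  simp [mem_openUnitCube_iff]

/-- `Q⁴ = [(0,1)⁴, g⊗g⊗g⊗g]`. [folklore] -/
def G4 : KZ.IntegralRep 4 := G2.prod G2

/-- The domain of `Q⁴` is the open cube `(0,1)⁴`. [folklore] -/
theorem G4_domain : G4.domain = openUnitCube 4 := by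
  ext z
  rw [G4, KZ.IntegralRep.prod_domain, KZ.IntegralRep.mem_prodDomain, G2_domain, mem_cube2, mem_cube2,
    mem_cube4']
  simp only [Fin.forall_fin_succ, IsEmpty.forall_iff, and_true]
  simp [Fin.natAdd, Fin.castAdd]
  tauto

/-- The integrand of `Q⁴`, unfolded. [folklore] -/
theorem G4_integrand_apply (z : Fin 4 → ℝ) : G4.integrand z = gq (z 0) * gq (z 1) * (gq (z 2) * gq (z 3)) := by
  rw [G4, KZ.IntegralRep.prod_integrand_eq, KZ.IntegralRep.prodFun_apply, G2_integrand_apply, G2_integrand_apply]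
  simp [Fin.natAdd, Fin.castAdd]

/-- The integrand of `Q⁴` as a product over the coordinates. [folklore] -/
theorem G4_integrand_prod (z : Fin 4 → ℝ) : G4.integrand z = ∏ i, gq (z i) := by
  rw [G4_integrand_apply, Fin.prod_univ_four]; ring

/-- `[Q²]·[Q²] = [Q⁴]` in the formal ring. [folklore] -/
theorem of_G2_mul_of_G2 : KZ.of G2 * KZ.of G2 = KZ.of G4 := KZ.of_mul_of _ _

/-- Membership in `G4_domain`, unfolded. [folklore] -/
theorem mem_G4_domain {z : Fin 4 → ℝ} : z ∈ G4.domain ↔ ∀ i, 0 < z i ∧ z i < 1 := by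
  rw [G4_domain, mem_cube4']

/-- The bottom-pair cell: coordinates `i, j` both below coordinates `k, l`. [folklore] -/
def bp (i j k l : Fin 4) : Set (Fin 4 → ℝ) :=
  G4.domain ∩ {z | z i < z k ∧ z i < z l ∧ z j < z k ∧ z j < z l}

/-- `bp` lies in the ambient domain. [folklore] -/
theorem bp_subset (i j k l : Fin 4) : bp i j k l ⊆ G4.domain := inter_subset_left

/-- `lt4` is `ℚ`-semialgebraic. [folklore] -/
theorem isSemialgebraic_lt4 (i j : Fin 4) : IsSemialgebraic ℚ {z : Fin 4 → ℝ | z j < z i} := by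
  convert Literature.ModelTheory.ExponentialFields.isSemialgebraic_setOf_eval_pos (R := ℝ)
    (X i - X j : MvPolynomial (Fin 4) ℚ) using 1
  ext z; simp [sub_pos]

/-- `bp` is `ℚ`-semialgebraic. [folklore] -/
theorem isSemialgebraic_bp (i j k l : Fin 4) : IsSemialgebraic ℚ (bp i j k l) := by
  refine G4.isSemialgebraic_domain.inter ?_
  have : {z : Fin 4 → ℝ | z i < z k ∧ z i < z l ∧ z j < z k ∧ z j < z l} =
      {z | z i < z k} ∩ {z | z i < z l} ∩ {z | z j < z k} ∩ {z | z j < z l} := by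
    ext z; simp [and_assoc]
  rw [this]
  exact (((isSemialgebraic_lt4 _ _).inter (isSemialgebraic_lt4 _ _)).inter (isSemialgebraic_lt4 _ _)).inter
    (isSemialgebraic_lt4 _ _)

/-- The restriction of `Q⁴` to a bottom-pair cell. [folklore] -/
def bpRep (i j k l : Fin 4) : KZ.IntegralRep 4 :=
  G4.restrict (bp i j k l) (isSemialgebraic_bp i j k l) (bp_subset i j k l)

/-- The base cell `U = {z₀, z₂ < z₁, z₃}`. [folklore] -/
abbrev Urep : KZ.IntegralRep 4 := bpRep 0 2 1 3

/-- Membership in `bp`, unfolded. [folklore] -/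
theorem mem_bp {i j k l : Fin 4} {z : Fin 4 → ℝ} :
    z ∈ bp i j k l ↔ z ∈ G4.domain ∧ z i < z k ∧ z i < z l ∧ z j < z k ∧ z j < z l := Iff.rfl

/-- **Every bottom-pair cell is the base cell up to a coordinate permutation.** [folklore] -/
theorem bpRep_equiv (i j k l : Fin 4) (e : Equiv.Perm (Fin 4)) (hi : e i = 0) (hj : e j = 2) (hk : e k = 1)
    (hl : e l = 3) : KZ.of (bpRep i j k l) - KZ.of Urep ∈ KZ.relations := by
  have h1 := KZ.of_sub_of_reindex_mem_relations (bpRep i j k l) e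
  have h2 : KZ.of ((bpRep i j k l).reindex e) - KZ.of Urep ∈ KZ.relations := by
    refine of_sub_of_mem_relations_of_eqOn ?_ ?_
    · ext w
      simp only [bpRep, KZ.IntegralRep.domain_restrict, KZ.IntegralRep.reindex_domain, mem_setOf_eq]
      change w ∈ bp 0 2 1 3 ↔ (fun m => w (e m)) ∈ bp i j k l
      rw [mem_bp, mem_bp, hi, hj, hk, hl, mem_G4_domain, mem_G4_domain]
      constructor
      · rintro ⟨hw, c⟩
        exact ⟨fun m => hw (e m), c⟩
      · rintro ⟨hw, c⟩
        refine ⟨fun m => ?_, c⟩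
        simpa using hw (e.symm m)
    · intro w _
      simp only [bpRep, KZ.IntegralRep.reindex_integrand, KZ.IntegralRep.integrand_restrict, G4_integrand_prod]
      exact (Equiv.prod_comp e (fun m => gq (w m)))
  have : KZ.of (bpRep i j k l) - KZ.of Urep = (KZ.of (bpRep i j k l) - KZ.of ((bpRep i j k l).reindex e)) +
      (KZ.of ((bpRep i j k l).reindex e) - KZ.of Urep) := by abel
  rw [this]
  exact add_mem h1 h2

/-- The five non-base cells and their sorting permutations. [folklore] -/
def e01 : Equiv.Perm (Fin 4) := ⟨![0, 2, 1, 3], ![0, 2, 1, 3], by decide, by decide⟩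
/-- Sorting permutation of the cell with bottom pair `{0,3}`. [folklore] -/
def e03 : Equiv.Perm (Fin 4) := ⟨![0, 1, 3, 2], ![0, 1, 3, 2], by decide, by decide⟩
/-- Sorting permutation of the cell with bottom pair `{1,2}`. [folklore] -/
def e12 : Equiv.Perm (Fin 4) := ⟨![1, 0, 2, 3], ![1, 0, 2, 3], by decide, by decide⟩
/-- Sorting permutation of the cell with bottom pair `{1,3}`. [folklore] -/
def e13 : Equiv.Perm (Fin 4) := ⟨![1, 0, 3, 2], ![1, 0, 3, 2], by decide, by decide⟩
/-- Sorting permutation of the cell with bottom pair `{2,3}`. [folklore] -/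
def e23 : Equiv.Perm (Fin 4) := ⟨![1, 3, 0, 2], ![2, 0, 3, 1], by decide, by decide⟩

/-- The cell of `bp01` is the base cell up to a coordinate permutation. [folklore] -/
theorem bp01_equiv : KZ.of (bpRep 0 1 2 3) - KZ.of Urep ∈ KZ.relations :=
  bpRep_equiv 0 1 2 3 e01 (by decide) (by decide) (by decide) (by decide)
/-- The cell of `bp03` is the base cell up to a coordinate permutation. [folklore] -/
theorem bp03_equiv : KZ.of (bpRep 0 3 1 2) - KZ.of Urep ∈ KZ.relations :=
  bpRep_equiv 0 3 1 2 e03 (by decide) (by decide) (by decide) (by decide)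
/-- The cell of `bp12` is the base cell up to a coordinate permutation. [folklore] -/
theorem bp12_equiv : KZ.of (bpRep 1 2 0 3) - KZ.of Urep ∈ KZ.relations :=
  bpRep_equiv 1 2 0 3 e12 (by decide) (by decide) (by decide) (by decide)
/-- The cell of `bp13` is the base cell up to a coordinate permutation. [folklore] -/
theorem bp13_equiv : KZ.of (bpRep 1 3 0 2) - KZ.of Urep ∈ KZ.relations :=
  bpRep_equiv 1 3 0 2 e13 (by decide) (by decide) (by decide) (by decide)
/-- The cell of `bp23` is the base cell up to a coordinate permutation. [folklore] -/
theorem bp23_equiv : KZ.of (bpRep 2 3 0 1) - KZ.of Urep ∈ KZ.relations :=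
  bpRep_equiv 2 3 0 1 e23 (by decide) (by decide) (by decide) (by decide)

/-- Peeling (rule 1a with disjoint pieces) for `G4`. [folklore] -/
theorem peel4 {T : Set (Fin 4 → ℝ)} (hT : IsSemialgebraic ℚ T) (hTD : T ⊆ G4.domain)
    (i j k l : Fin 4) (ha : bp i j k l ⊆ T) :
    KZ.of (G4.restrict T hT hTD) - KZ.of (bpRep i j k l) -
      KZ.of (G4.restrict (T \ bp i j k l) (hT.diff (isSemialgebraic_bp i j k l)) (Set.sdiff_subset.trans hTD)) ∈
      KZ.domainAddRel := by
  refine ⟨4, G4.restrict T hT hTD, bpRep i j k l, G4.restrict (T \ bp i j k l) (hT.diff (isSemialgebraic_bp i j k l))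
    (Set.sdiff_subset.trans hTD), ?_, ?_, fun _ _ => rfl, fun _ _ => rfl, rfl⟩
  · change T = bp i j k l ∪ (T \ bp i j k l)
    rw [Set.union_sdiff_cancel ha]
  · change volume (bp i j k l ∩ (T \ bp i j k l)) = 0
    rw [Set.inter_sdiff_self, measure_empty]

/-- The remainders. [folklore] -/
def S1 : Set (Fin 4 → ℝ) := G4.domain \ bp 0 2 1 3
/-- Remainder after peeling two cells. [folklore] -/
def S2 : Set (Fin 4 → ℝ) := S1 \ bp 0 1 2 3
/-- Remainder after peeling three cells. [folklore] -/
def S3 : Set (Fin 4 → ℝ) := S2 \ bp 0 3 1 2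
/-- Remainder after peeling four cells. [folklore] -/
def S4 : Set (Fin 4 → ℝ) := S3 \ bp 1 2 0 3
/-- Remainder after peeling five cells. [folklore] -/
def S5 : Set (Fin 4 → ℝ) := S4 \ bp 1 3 0 2
/-- Remainder after peeling all six cells. [folklore] -/
def S6 : Set (Fin 4 → ℝ) := S5 \ bp 2 3 0 1

/-- `S1` is `ℚ`-semialgebraic. [folklore] -/
theorem sa_S1 : IsSemialgebraic ℚ S1 := G4.isSemialgebraic_domain.diff (isSemialgebraic_bp _ _ _ _)
/-- `S2` is `ℚ`-semialgebraic. [folklore] -/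
theorem sa_S2 : IsSemialgebraic ℚ S2 := sa_S1.diff (isSemialgebraic_bp _ _ _ _)
/-- `S3` is `ℚ`-semialgebraic. [folklore] -/
theorem sa_S3 : IsSemialgebraic ℚ S3 := sa_S2.diff (isSemialgebraic_bp _ _ _ _)
/-- `S4` is `ℚ`-semialgebraic. [folklore] -/
theorem sa_S4 : IsSemialgebraic ℚ S4 := sa_S3.diff (isSemialgebraic_bp _ _ _ _)
/-- `S5` is `ℚ`-semialgebraic. [folklore] -/
theorem sa_S5 : IsSemialgebraic ℚ S5 := sa_S4.diff (isSemialgebraic_bp _ _ _ _)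
/-- `S6` is `ℚ`-semialgebraic. [folklore] -/
theorem sa_S6 : IsSemialgebraic ℚ S6 := sa_S5.diff (isSemialgebraic_bp _ _ _ _)
/-- `S1` lies in the domain of `Q⁴`. [folklore] -/
theorem S1_sub : S1 ⊆ G4.domain := Set.sdiff_subset
/-- `S2` lies in the domain of `Q⁴`. [folklore] -/
theorem S2_sub : S2 ⊆ G4.domain := Set.sdiff_subset.trans S1_sub
/-- `S3` lies in the domain of `Q⁴`. [folklore] -/
theorem S3_sub : S3 ⊆ G4.domain := Set.sdiff_subset.trans S2_sub
/-- `S4` lies in the domain of `Q⁴`. [folklore] -/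
theorem S4_sub : S4 ⊆ G4.domain := Set.sdiff_subset.trans S3_sub
/-- `S5` lies in the domain of `Q⁴`. [folklore] -/
theorem S5_sub : S5 ⊆ G4.domain := Set.sdiff_subset.trans S4_sub
/-- `S6` lies in the domain of `Q⁴`. [folklore] -/
theorem S6_sub : S6 ⊆ G4.domain := Set.sdiff_subset.trans S5_sub

/-- Distinct bottom-pair cells are disjoint. [folklore] -/
theorem bp_disjoint {i j k l i' j' k' l' : Fin 4} {z : Fin 4 → ℝ} (h : z ∈ bp i j k l) (h' : z ∈ bp i' j' k' l')
    (hx : (i = k' ∨ i = l') ∧ (i' = k ∨ i' = l ∨ j' = k ∨ j' = l) ∨ (j = k' ∨ j = l') ∧ (i' = k ∨ i' = l ∨ j' = k ∨ j' = l)) :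
    False := by
  obtain ⟨-, a1, a2, a3, a4⟩ := h
  obtain ⟨-, b1, b2, b3, b4⟩ := h'
  rcases hx with ⟨hx1 | hx1, hx2 | hx2 | hx2 | hx2⟩ | ⟨hx1 | hx1, hx2 | hx2 | hx2 | hx2⟩ <;> subst hx1 <;> subst hx2 <;>
    linarith

/-- The cell `bp01` survives the previous peelings. [folklore] -/
theorem bp01_sub_S1 : bp 0 1 2 3 ⊆ S1 := fun z hz =>
  ⟨bp_subset _ _ _ _ hz, fun h => bp_disjoint hz h (by decide)⟩
/-- The cell `bp03` survives the previous peelings. [folklore] -/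
theorem bp03_sub_S2 : bp 0 3 1 2 ⊆ S2 := fun z hz =>
  ⟨⟨bp_subset _ _ _ _ hz, fun h => bp_disjoint hz h (by decide)⟩, fun h => bp_disjoint hz h (by decide)⟩
/-- The cell `bp12` survives the previous peelings. [folklore] -/
theorem bp12_sub_S3 : bp 1 2 0 3 ⊆ S3 := fun z hz =>
  ⟨⟨⟨bp_subset _ _ _ _ hz, fun h => bp_disjoint hz h (by decide)⟩, fun h => bp_disjoint hz h (by decide)⟩,
    fun h => bp_disjoint hz h (by decide)⟩
/-- The cell `bp13` survives the previous peelings. [folklore] -/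
theorem bp13_sub_S4 : bp 1 3 0 2 ⊆ S4 := fun z hz =>
  ⟨⟨⟨⟨bp_subset _ _ _ _ hz, fun h => bp_disjoint hz h (by decide)⟩, fun h => bp_disjoint hz h (by decide)⟩,
    fun h => bp_disjoint hz h (by decide)⟩, fun h => bp_disjoint hz h (by decide)⟩
/-- The cell `bp23` survives the previous peelings. [folklore] -/
theorem bp23_sub_S5 : bp 2 3 0 1 ⊆ S5 := fun z hz =>
  ⟨⟨⟨⟨⟨bp_subset _ _ _ _ hz, fun h => bp_disjoint hz h (by decide)⟩, fun h => bp_disjoint hz h (by decide)⟩,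
    fun h => bp_disjoint hz h (by decide)⟩, fun h => bp_disjoint hz h (by decide)⟩, fun h => bp_disjoint hz h (by decide)⟩

/-- The walls `zₐ = z_b`. [folklore] -/
def walls4 : Set (Fin 4 → ℝ) :=
  {z | z 0 = z 1} ∪ {z | z 0 = z 2} ∪ {z | z 0 = z 3} ∪ {z | z 1 = z 2} ∪ {z | z 1 = z 3} ∪ {z | z 2 = z 3}

/-- **Off the walls, the two smallest coordinates form one of the six pairs** (trichotomy). [folklore] -/
theorem S6_subset_walls : S6 ⊆ walls4 := by
  intro z hz
  obtain ⟨⟨⟨⟨⟨⟨hD, n02⟩, n01⟩, n03⟩, n12⟩, n13⟩, n23⟩ := hz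
  simp only [walls4, mem_union, mem_setOf_eq]
  by_contra hw
  simp only [not_or] at hw
  obtain ⟨⟨⟨⟨⟨w01, w02⟩, w03⟩, w12⟩, w13⟩, w23⟩ := hw
  rcases lt_or_gt_of_ne w01 with h01 | h01 <;> rcases lt_or_gt_of_ne w02 with h02 | h02 <;>
  rcases lt_or_gt_of_ne w03 with h03 | h03 <;> rcases lt_or_gt_of_ne w12 with h12 | h12 <;>
  rcases lt_or_gt_of_ne w13 with h13 | h13 <;> rcases lt_or_gt_of_ne w23 with h23 | h23 <;>
  first
    | exact n02 ⟨hD, by assumption, by assumption, by assumption, by assumption⟩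
    | exact n01 ⟨hD, by assumption, by assumption, by assumption, by assumption⟩
    | exact n03 ⟨hD, by assumption, by assumption, by assumption, by assumption⟩
    | exact n12 ⟨hD, by assumption, by assumption, by assumption, by assumption⟩
    | exact n13 ⟨hD, by assumption, by assumption, by assumption, by assumption⟩
    | exact n23 ⟨hD, by assumption, by assumption, by assumption, by assumption⟩
    | (exfalso; linarith)

/-- `hyperplane4` is Lebesgue-null. [folklore] -/
theorem volume_hyperplane4 {i j : Fin 4} (hij : i ≠ j) : volume {z : Fin 4 → ℝ | z i = z j} = 0 := by
  let L : (Fin 4 → ℝ) →ₗ[ℝ] ℝ :=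
    LinearMap.proj (R := ℝ) (φ := fun _ : Fin 4 => ℝ) i - LinearMap.proj (R := ℝ) (φ := fun _ : Fin 4 => ℝ) j
  have hker : {z : Fin 4 → ℝ | z i = z j} = (LinearMap.ker L : Set (Fin 4 → ℝ)) := by
    ext z; simp [L, sub_eq_zero]
  rw [hker]
  refine Measure.addHaar_submodule volume (LinearMap.ker L) ?_
  intro htop
  have hmem : (Pi.single i (1 : ℝ) : Fin 4 → ℝ) ∈ LinearMap.ker L := by rw [htop]; trivial
  have : (Pi.single i (1 : ℝ) : Fin 4 → ℝ) i = (Pi.single i (1 : ℝ) : Fin 4 → ℝ) j := by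
    simpa [L, sub_eq_zero] using hmem
  simp [hij.symm] at this

/-- `walls4` is Lebesgue-null. [folklore] -/
theorem volume_walls4 : volume walls4 = 0 := by
  simp only [walls4]
  refine measure_union_null (measure_union_null (measure_union_null (measure_union_null (measure_union_null ?_ ?_)
    ?_) ?_) ?_) ?_ <;> exact volume_hyperplane4 (by decide)

/-- `S6` is Lebesgue-null. [folklore] -/
theorem volume_S6 : volume S6 = 0 := measure_mono_null S6_subset_walls volume_walls4

/-- `Q⁴` restricted to its own domain is `Q⁴`. [folklore] -/
theorem restrict_G4_self : G4.restrict G4.domain G4.isSemialgebraic_domain subset_rfl = G4 :=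
  KZ.IntegralRep.ext' rfl rfl

/-- **`Q⁴ ≡ 6·[U]`.** [folklore] -/
theorem of_G4_sub_six_Urep_mem : KZ.of G4 - 6 • KZ.of Urep ∈ KZ.relations := by
  have p1 := KZ.domainAddRel_subset_relations (peel4 G4.isSemialgebraic_domain subset_rfl 0 2 1 3 (bp_subset _ _ _ _))
  rw [restrict_G4_self] at p1
  have p2 := KZ.domainAddRel_subset_relations (peel4 sa_S1 S1_sub 0 1 2 3 bp01_sub_S1)
  have p3 := KZ.domainAddRel_subset_relations (peel4 sa_S2 S2_sub 0 3 1 2 bp03_sub_S2)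
  have p4 := KZ.domainAddRel_subset_relations (peel4 sa_S3 S3_sub 1 2 0 3 bp12_sub_S3)
  have p5 := KZ.domainAddRel_subset_relations (peel4 sa_S4 S4_sub 1 3 0 2 bp13_sub_S4)
  have p6 := KZ.domainAddRel_subset_relations (peel4 sa_S5 S5_sub 2 3 0 1 bp23_sub_S5)
  have p7 : KZ.of (G4.restrict S6 sa_S6 S6_sub) ∈ KZ.relations :=
    KZ.levelRel_le_relations (KZ.of_mem_levelRel_of_volume_eq_zero _ volume_S6)
  have q1 := bp01_equiv; have q2 := bp03_equiv; have q3 := bp12_equiv; have q4 := bp13_equiv; have q5 := bp23_equiv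
  set G := KZ.of G4
  set U := KZ.of Urep
  set A := KZ.of (bpRep 0 1 2 3); set B := KZ.of (bpRep 0 3 1 2); set C := KZ.of (bpRep 1 2 0 3)
  set D := KZ.of (bpRep 1 3 0 2); set E := KZ.of (bpRep 2 3 0 1)
  set R1 := KZ.of (G4.restrict S1 sa_S1 S1_sub); set R2 := KZ.of (G4.restrict S2 sa_S2 S2_sub)
  set R3 := KZ.of (G4.restrict S3 sa_S3 S3_sub); set R4 := KZ.of (G4.restrict S4 sa_S4 S4_sub)
  set R5 := KZ.of (G4.restrict S5 sa_S5 S5_sub); set R6 := KZ.of (G4.restrict S6 sa_S6 S6_sub)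
  have : G - 6 • U = (G - U - R1) + (R1 - A - R2) + (R2 - B - R3) + (R3 - C - R4) + (R4 - D - R5) + (R5 - E - R6)
      + R6 + (A - U) + (B - U) + (C - U) + (D - U) + (E - U) := by
    abel
  rw [this]
  exact add_mem (add_mem (add_mem (add_mem (add_mem (add_mem (add_mem (add_mem (add_mem (add_mem (add_mem p1 p2)
    p3) p4) p5) p6) p7) q1) q2) q3) q4) q5

end Summit.KontsevichZagierPeriods.MzvKernelInKZ.Negative
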